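import Literature.NumberTheory.LFunctions.ZetaLFunctionProductBounds
import Literature.NumberTheory.LFunctions.CertifiedLFunctionGaussianWindow
import Literature.Analysis.Complex.VerticalLineShift
import HarnessLib

/-!
# Platt's aliasing bound for the windowed completed `L`-function
# (Math. Comp. 85 (2016) §8, Lemma 8.5)

Topic `Literature/NumberTheory/LFunctions`; namespace `Literature.NumberTheory.LFunctions`, engine
sub-namespace `WindowAliasing`. Everything in this file is PROVED (no named fact, no new definition).
Typed for the parity-realchar cell (D-0088 (4) literature-typing layer, row «Platt 2016 (Math. Comp.,
certified GRH/`L`-function computations)»): instrument provenance for the rigorous up-sampling step of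
Platt's GRH verification `Literature.NumberTheory.LFunctions.platt2016_theorem71/72`
(`DirichletLRiemannHypothesisUpTo.lean`).

Setting (pp. 3009, 3021). For a primitive character `χ` mod `q`, parity `a_χ ∈ {0, 1}` and a unit
`ε_χ`, Platt's completed `L`-function on the critical line is
`Λ_χ(t) := ε_χ (q/π)^{it/2} Γ((1/2 + a_χ + it)/2) exp(πt/4) L_χ(1/2 + it)` (p. 3009), windowed as
`W(t, χ) := Λ_χ(t) exp(-(t - t₀)²/(2h²))` (`t₀ ∈ ℝ`, `h > 0`; p. 3021). The up-sampling theorems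
(Theorems 8.1–8.2, `CertifiedLFunctionUpsampling.lean`) are applied to `W`, which is only approximately
band-limited; the aliasing error is controlled by

  `I_χ(A) := 4 ∫_{πA}^{∞} |(1/(2π)) ∫_{-∞}^{∞} W(t, χ) exp(-ixt) dt| dx`.

## Contents (all proved)

* `platt2016_lemma85` — **Lemma 8.5 as printed** (p. 3022): writing `M = 5/2 - a_χ`,
  `I_χ(A) ≤ 2 (q/π)^{M/2} ζ(M + 1/2) exp(M²/(2h²) - πAM) P(t₀, h)/(πM)`, with
  `P(t₀, h) = ∫ |Γ((3+it)/2)| e^{πt/4} e^{-(t-t₀)²/(2h²)} dt` the integral of Lemma 8.4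
  (`platt2016_lemma84`, `CertifiedLFunctionGaussianWindow.lean`) and `ζ(M + 1/2)` the tree's real
  `Booker2006Turing.bigZ (M + 1/2) = Re ζ(M + 1/2)` (`M + 1/2 = 3 - a_χ ≥ 2`). `W` is written out over
  Mathlib's `DirichletCharacter.LFunction` and `Complex.Gamma`, for any `ε` with `‖ε‖ = 1`; the outer
  integral is the Bochner integral over `Ioi (πA)` (the printed `A > 0` is not used: the bound holds for
  every real `A`).
* Engine (`WindowAliasing.*`, the steps of the printed proof, pp. 3022–3023): the integrand
  `Ψ_x(s) = ε (q/π)^{(s-1/2)/2} Γ((s+a_χ)/2) exp(πi(1/2-s)/4) L_χ(s) exp((1/2-s)x) exp(-(i(1/2-s)-t₀)²/(2h²))`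
  of the printed display "Writing `s = 1/2 + it` we get …" and the identity
  `W(t, χ) e^{-ixt} = Ψ_x(1/2 + it)` (`window_mul_exp_eq`); holomorphy of `Ψ_x` on `Re s ≥ 1/2`
  (`differentiableAt_integrand`); a uniform majorant on the strip `1/2 ≤ Re s ≤ 3 - a_χ`
  (`norm_integrand_le`, from Rademacher's convexity bound — the tree's `Rademacher1959.norm_LFunction_le`,
  Platt's Lemma 7.3 source — and `|L_χ(s)| ≤ ζ(Re s)` beyond `Re s = 3/2`), hence integrability on every
  vertical line of the strip (`integrable_integrand_vertical`) and uniform decay at its top and bottom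
  (`decay_integrand`, the Gaussian factor beating the linear growth); the bound on the shifted line
  `Re s = 3 - a_χ = M + 1/2` (`norm_integrand_far_le`):
  `|Ψ_x(M + 1/2 + it)| ≤ (q/π)^{M/2} |Γ((3+it)/2)| e^{πt/4} ζ(M+1/2) e^{-Mx} e^{(M² - (t-t₀)²)/(2h²)}`,
  the printed display of p. 3023.

## Method (the printed proof, pp. 3022–3023)

"Writing `s = 1/2 + it`" the inner Fourier integral is `(1/i) ∫_{Re s = 1/2} Ψ_x(s) ds`; "we now shift the
contour of integration to the right so that `Re s = σ = 3 - a_χ` and write `s = M + 1/2 + it`": there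
`|(q/π)^{(s-1/2)/2}| = (q/π)^{M/2}`, `Γ((s + a_χ)/2) = Γ((3+it)/2)` for both parities,
`|exp(πi(1/2-s)/4)| = e^{πt/4}`, `|L_χ(s)| ≤ ζ(M + 1/2)`, `|exp((1/2-s)x)| = e^{-Mx}` and
`|exp(-(i(1/2-s)-t₀)²/(2h²))| = e^{(M² - (t-t₀)²)/(2h²)}`; "integrating with respect to `t` gives us"
`I_χ(A) ≤ (2/π)(q/π)^{M/2} ζ(M+1/2) e^{M²/(2h²)} P(t₀, h) ∫_{πA}^∞ e^{-Mx} dx` "and the result follows after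
integrating with respect to `x`". The contour shift, implicit in the paper, is the tree's
`Literature.Analysis.Complex.integral_vertical_eq_of_differentiableOn` (rectangles `|Im s| ≤ T`,
`T → ∞`): `Ψ_x` is entire on `Re s > -a_χ` because `L_χ` is entire for primitive `χ`, `q > 1`
(Mathlib's `DirichletCharacter.differentiable_LFunction`), and on the strip
`|Ψ_x(σ + iT)| ≪_{q,x,h} (1 + |T|) e^{πT/4} e^{-(T-t₀)²/(2h²)} → 0`.

NOT here: Lemma 8.3 (explicit Stirling for `|Γ((1/2+it+a_χ)/2)| e^{πt/4}`) — PROVED in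
`CertifiedLFunctionGammaFactorBound.lean` (`platt2016_lemma83`); Lemma 8.6 (its majorant
`G(n+1)/G(n)` decreasing needs a hypothesis on `S, A, h` left implicit in print) and Lemma 8.7 ("for large
enough `t₀`") — both PROVED, in the form the printed proof yields (real `t₀` off the sample grid, the
proviso `A h ≤ S`, `t₀ ≥ 12`), in `CertifiedLFunctionUpsamplingTruncation.lean` (`platt2016_lemma86`,
`platt2016_lemma87`, `platt2016_lemma87_of_twelve_le`, `platt2016_lemma87_uniform`; 2026-08-27); and the
numerical choice of `A, h, S` (§9) — recorded by the g5/g7/g8 seats.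

`lean search` (2026-08-27): the tree has the vertical-line shift lemma, Rademacher's Theorem 3,
`Booker2006Turing.norm_LFunction_le_bigZ` (`|L(σ+it)| ≤ ζ(σ)`, `σ > 1`), `Hoffstein1980.bigZ_antitone'`,
`GammaVert.norm_Gamma_le_Gamma_re`, `charParity`, and Lemma 8.4 with the integrability of `P`'s
integrand (`platt2016_lemma84_integrable`); Mathlib supplies `integral_exp_mul_Ioi`,
`norm_integral_le_integral_norm`, the Gaussian integrability lemmas. Nothing is restated.

## References

* [Platt2016GRH] D. J. Platt, *Numerical computations concerning the GRH*, Math. Comp. 85 (2016),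
  no. 302, 3009–3027, doi:10.1090/mcom/3077: `Λ_χ` p. 3009, §8 "Rigorous up-sampling", `W(t, χ)`
  p. 3021, Lemma 8.5 p. 3022, proof pp. 3022–3023 (arXiv:1305.3087v1 §6, Lemma 6.4).
* [Rademacher1959] H. Rademacher, *On the Phragmén–Lindelöf theorem and some applications*, Math. Z.
  72 (1959) 192–204, Theorem 3 (the tree's `RademacherDirichletLConvexity.lean`; Platt's [14], used in
  his Lemma 7.3).
-/

noncomputable section

open Complex Filter Topology Set MeasureTheory DirichletCharacter
open scoped Real

namespace Literature.NumberTheory.LFunctions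

namespace WindowAliasing

/-! ## §1 Norms of the factors of `Ψ_x(s)` at `s = σ + iτ` -/

/-- `‖(q/π)^{(s-1/2)/2}‖ = (q/π)^{(Re s - 1/2)/2}` (`q > 0`). [folklore] -/
private theorem norm_base_cpow {q : ℕ} (hq : 0 < q) (s : ℂ) :
    ‖((q : ℂ) / π) ^ ((s - 1 / 2) / 2)‖ = ((q : ℝ) / π) ^ ((s.re - 1 / 2) / 2) := by
  have hqπ : 0 < (q : ℝ) / π := div_pos (by exact_mod_cast hq) Real.pi_pos
  rw [show ((q : ℂ) / π) = (((q : ℝ) / π : ℝ) : ℂ) by push_cast; ring,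
    Complex.norm_cpow_eq_rpow_re_of_pos hqπ]
  congr 1
  simp

/-- `‖Γ((s+a)/2)‖ ≤ Γ((Re s + a)/2)` for `Re s + a > 0` (the tree's `GammaVert.norm_Gamma_le_Gamma_re`).
[folklore] -/
private theorem norm_Gamma_factor_le (a : ℕ) {s : ℂ} (hs : 0 < s.re + a) :
    ‖Complex.Gamma ((s + a) / 2)‖ ≤ Real.Gamma ((s.re + a) / 2) := by
  have hre : ((s + a) / 2 : ℂ).re = (s.re + a) / 2 := by simp
  have h := norm_Gamma_le_Gamma_re (s := (s + a) / 2) (by rw [hre]; linarith)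
  rwa [hre] at h

/-- Convexity of `Γ` on `(0, ∞)`: `Γ(x) ≤ max (Γ lo) (Γ hi)` on `[lo, hi]`. [folklore] -/
private theorem Real_Gamma_le_max {x lo hi : ℝ} (hlo : 0 < lo) (h1 : lo ≤ x) (h2 : x ≤ hi) :
    Real.Gamma x ≤ max (Real.Gamma lo) (Real.Gamma hi) := by
  have hseg : x ∈ segment ℝ lo hi := by
    rw [segment_eq_Icc (h1.trans h2)]; exact ⟨h1, h2⟩
  exact Real.convexOn_Gamma.le_on_segment hlo (hlo.trans_le (h1.trans h2)) hseg

/-- `‖exp(πi(1/2-s)/4)‖ = e^{π Im s/4}`. [folklore] -/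
private theorem norm_exp_phase (s : ℂ) :
    ‖Complex.exp (π * I * (1 / 2 - s) / 4)‖ = Real.exp (π * s.im / 4) := by
  rw [Complex.norm_exp]
  congr 1
  simp [Complex.mul_re, Complex.mul_im]

/-- `‖exp((1/2-s)x)‖ = e^{(1/2 - Re s)x}`. [folklore] -/
private theorem norm_exp_shift (s : ℂ) (x : ℝ) :
    ‖Complex.exp ((1 / 2 - s) * x)‖ = Real.exp ((1 / 2 - s.re) * x) := by
  rw [Complex.norm_exp]
  congr 1
  simp [Complex.mul_re]

/-- `‖exp(-(i(1/2-s)-t₀)²/(2h²))‖ = exp(((Re s - 1/2)² - (Im s - t₀)²)/(2h²))`. [folklore] -/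
private theorem norm_exp_gauss (s : ℂ) (t₀ h : ℝ) :
    ‖Complex.exp (-(I * (1 / 2 - s) - t₀) ^ 2 / (2 * h ^ 2))‖ =
      Real.exp (((s.re - 1 / 2) ^ 2 - (s.im - t₀) ^ 2) / (2 * h ^ 2)) := by
  rw [Complex.norm_exp]
  congr 1
  have e : (I * (1 / 2 - s) - t₀ : ℂ) = ((s.im - t₀ : ℝ) : ℂ) + ((1 / 2 - s.re : ℝ) : ℂ) * I := by
    apply Complex.ext <;> simp
  have e2 : (2 * (h : ℂ) ^ 2) = ((2 * h ^ 2 : ℝ) : ℂ) := by push_cast; ring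
  rw [e, e2, Complex.div_ofReal_re, Complex.neg_re, sq, Complex.mul_re, Complex.add_re,
    Complex.add_im, Complex.ofReal_re, Complex.ofReal_im, Complex.re_ofReal_mul, Complex.im_ofReal_mul,
    Complex.I_re, Complex.I_im]
  ring

/-- `y^e ≤ 1 + y` for `y ≥ 0`, `0 ≤ e ≤ 1`. [folklore] -/
private theorem rpow_le_one_add {y e : ℝ} (hy : 0 ≤ y) (he0 : 0 ≤ e) (he1 : e ≤ 1) : y ^ e ≤ 1 + y := by
  rcases le_or_gt 1 y with h | h
  · calc y ^ e ≤ y ^ (1 : ℝ) := Real.rpow_le_rpow_of_exponent_le h he1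
      _ = y := Real.rpow_one y
      _ ≤ 1 + y := by linarith
  · calc y ^ e ≤ 1 := Real.rpow_le_one hy h.le he0
      _ ≤ 1 + y := by linarith

/-- **A uniform majorant for `L_χ` on the strip `1/2 ≤ Re s ≤ 3`** (primitive `χ`, `q > 1`):
`‖L_χ(s)‖ ≤ ζ(3/2)(1 + q(5 + |Im s|)/(2π))` — Rademacher's convexity bound (the tree's
`Rademacher1959.norm_LFunction_le` with `η = 1/2`, Platt's [14] behind his Lemma 7.3) up to `Re s = 3/2`
and `|L_χ(s)| ≤ ζ(Re s) ≤ ζ(3/2)` beyond; only linear growth in `Im s` is kept, which is what the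
justification of the contour shift in the proof of Lemma 8.5 needs.
[cite: Platt2016GRH, Lemma 8.5 p. 3022 (proof pp. 3022–3023)] -/
theorem norm_LFunction_le_linear {q : ℕ} [NeZero q] (hq : 1 < q) {χ : DirichletCharacter ℂ q}
    (hχ : χ.IsPrimitive) {s : ℂ} (h1 : 1 / 2 ≤ s.re) (h2 : s.re ≤ 3) :
    ‖χ.LFunction s‖ ≤
      Booker2006Turing.bigZ (3 / 2) * (1 + q * (5 + |s.im|) / (2 * π)) := by
  have hZ : 0 < Booker2006Turing.bigZ (3 / 2) := Booker2006Turing.bigZ_pos (by norm_num)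
  have hqR : (0 : ℝ) < q := by exact_mod_cast (by omega : 0 < q)
  have hy0 : 0 ≤ (q : ℝ) * (5 + |s.im|) / (2 * π) := by positivity
  rcases le_or_gt s.re (3 / 2) with hlo | hhi
  · -- Rademacher with `η = 1/2`
    have h := Rademacher1959.norm_LFunction_le hq hχ (η := 1 / 2) (by norm_num) le_rfl (s := s)
      (by linarith) (by linarith)
    have hζ : (riemannZeta (1 + (1 / 2 : ℝ))).re = Booker2006Turing.bigZ (3 / 2) := by
      rw [Booker2006Turing.bigZ]; push_cast; norm_num
    rw [hζ] at h
    have hns : ‖1 + s‖ ≤ 5 + |s.im| := by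
      calc ‖1 + s‖ ≤ |(1 + s).re| + |(1 + s).im| := Complex.norm_le_abs_re_add_abs_im _
        _ = |1 + s.re| + |s.im| := by simp
        _ ≤ 5 + |s.im| := by
            have : |1 + s.re| ≤ 5 := by rw [abs_le]; constructor <;> linarith
            linarith
    have hbase : (q : ℝ) * ‖1 + s‖ / (2 * π) ≤ q * (5 + |s.im|) / (2 * π) := by
      gcongr
    have hexp0 : 0 ≤ (1 + 1 / 2 - s.re) / 2 := by linarith
    have hexp1 : (1 + 1 / 2 - s.re) / 2 ≤ 1 := by linarith
    calc ‖χ.LFunction s‖ ≤ (q * ‖1 + s‖ / (2 * π)) ^ ((1 + 1 / 2 - s.re) / 2) *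
          Booker2006Turing.bigZ (3 / 2) := h
      _ ≤ (q * (5 + |s.im|) / (2 * π)) ^ ((1 + 1 / 2 - s.re) / 2) *
          Booker2006Turing.bigZ (3 / 2) := by
          gcongr
      _ ≤ (1 + q * (5 + |s.im|) / (2 * π)) * Booker2006Turing.bigZ (3 / 2) := by
          gcongr
          exact rpow_le_one_add hy0 hexp0 hexp1
      _ = Booker2006Turing.bigZ (3 / 2) * (1 + q * (5 + |s.im|) / (2 * π)) := by ring
  · -- absolute convergence: `|L(s)| ≤ ζ(Re s) ≤ ζ(3/2)`
    have hs1 : 1 < s.re := by linarith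
    have h := Booker2006Turing.norm_LFunction_le_bigZ χ hs1 s.im
    rw [show ((s.re : ℂ) + (s.im : ℂ) * I) = s from Complex.re_add_im s] at h
    have hmono := Hoffstein1980.bigZ_antitone' (σ₁ := 3 / 2) (σ₂ := s.re) (by norm_num) hhi.le
    calc ‖χ.LFunction s‖ ≤ Booker2006Turing.bigZ s.re := h
      _ ≤ Booker2006Turing.bigZ (3 / 2) := hmono
      _ ≤ Booker2006Turing.bigZ (3 / 2) * (1 + q * (5 + |s.im|) / (2 * π)) := by
          nlinarith

/-! ## §2 The Gaussian window: completing the square, integrability, decay -/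

/-- Completing the square: `e^{πτ/4} e^{-(τ-t₀)²/(2h²)} = e^{(t₁²-t₀²)/(2h²)} e^{-(τ-t₁)²/(2h²)}`,
`t₁ = t₀ + πh²/4`. [folklore] -/
private theorem exp_mul_gauss_eq (t₀ h τ : ℝ) (hh : h ≠ 0) :
    Real.exp (π * τ / 4) * Real.exp (-(τ - t₀) ^ 2 / (2 * h ^ 2)) =
      Real.exp (((t₀ + π * h ^ 2 / 4) ^ 2 - t₀ ^ 2) / (2 * h ^ 2)) *
        Real.exp (-(τ - (t₀ + π * h ^ 2 / 4)) ^ 2 / (2 * h ^ 2)) := by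
  rw [← Real.exp_add, ← Real.exp_add]
  congr 1
  field_simp
  ring

/-- The Gaussian `exp(-(τ-c)²/(2h²))` is integrable (`h > 0`). [folklore] -/
private theorem integrable_gauss' {h : ℝ} (hh : 0 < h) (c : ℝ) :
    Integrable fun τ : ℝ => Real.exp (-(τ - c) ^ 2 / (2 * h ^ 2)) := by
  have hb : 0 < 1 / (2 * h ^ 2) := by positivity
  refine ((integrable_exp_neg_mul_sq hb).comp_sub_right c).congr (ae_of_all _ fun τ => ?_)
  simp only
  congr 1
  ring

/-- `|τ| exp(-(τ-c)²/(2h²))` is integrable (`h > 0`). [folklore] -/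
private theorem integrable_abs_mul_gauss {h : ℝ} (hh : 0 < h) (c : ℝ) :
    Integrable fun τ : ℝ => |τ| * Real.exp (-(τ - c) ^ 2 / (2 * h ^ 2)) := by
  have hb : 0 < 1 / (2 * h ^ 2) := by positivity
  have h1 : Integrable fun τ : ℝ => (τ - c) * Real.exp (-(τ - c) ^ 2 / (2 * h ^ 2)) := by
    refine ((integrable_mul_exp_neg_mul_sq hb).comp_sub_right c).congr (ae_of_all _ fun τ => ?_)
    simp only
    congr 2
    ring
  have h2 : Integrable fun τ : ℝ => τ * Real.exp (-(τ - c) ^ 2 / (2 * h ^ 2)) := by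
    refine (h1.add ((integrable_gauss' hh c).const_mul c)).congr (ae_of_all _ fun τ => ?_)
    simp only [Pi.add_apply]
    ring
  refine h2.norm.congr (ae_of_all _ fun τ => ?_)
  simp only [Real.norm_eq_abs, abs_mul, abs_of_pos (Real.exp_pos _)]

/-- `(c₁ + c₂|T|) e^{-(T-t₁)²/(2h²)} → 0` as `T → +∞`. [folklore] -/
private theorem tendsto_linear_mul_gauss_atTop (c₁ c₂ t₁ : ℝ) {h : ℝ} (hh : 0 < h) :
    Tendsto (fun T : ℝ => (c₁ + c₂ * |T|) * Real.exp (-(T - t₁) ^ 2 / (2 * h ^ 2)))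
      atTop (𝓝 0) := by
  -- substitute `u = T - t₁` and compare with `e^{-u}` for `u ≥ 2h²`
  have hmain : Tendsto (fun u : ℝ => (|c₁| + |c₂| * (|t₁| + u)) * Real.exp (-u)) atTop (𝓝 0) := by
    have h0 := Real.tendsto_pow_mul_exp_neg_atTop_nhds_zero 0
    have h1 := Real.tendsto_pow_mul_exp_neg_atTop_nhds_zero 1
    simp only [pow_zero, one_mul, pow_one] at h0 h1
    have := (h0.const_mul (|c₁| + |c₂| * |t₁|)).add (h1.const_mul |c₂|)
    simp only [mul_zero, add_zero] at this
    refine this.congr fun u => ?_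
    ring
  have hcomp : Tendsto (fun T : ℝ => (|c₁| + |c₂| * (|t₁| + (T - t₁))) * Real.exp (-(T - t₁)))
      atTop (𝓝 0) :=
    hmain.comp (tendsto_atTop_add_const_right _ (-t₁) tendsto_id)
  refine squeeze_zero_norm' ?_ hcomp
  filter_upwards [eventually_ge_atTop (t₁ + 2 * h ^ 2), eventually_ge_atTop (0 : ℝ)] with T hT hT0
  rw [Real.norm_eq_abs, abs_mul, abs_of_pos (Real.exp_pos _)]
  have hu : 2 * h ^ 2 ≤ T - t₁ := by linarith
  have hTt : 0 ≤ T - t₁ := le_trans (by positivity) hu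
  have hexp : Real.exp (-(T - t₁) ^ 2 / (2 * h ^ 2)) ≤ Real.exp (-(T - t₁)) := by
    rw [Real.exp_le_exp, neg_div, neg_le_neg_iff, le_div_iff₀ (by positivity)]
    nlinarith
  have hlin : abs (c₁ + c₂ * |T|) ≤ |c₁| + |c₂| * (|t₁| + (T - t₁)) := by
    calc abs (c₁ + c₂ * |T|) ≤ |c₁| + abs (c₂ * |T|) := abs_add_le _ _
      _ = |c₁| + |c₂| * |T| := by rw [abs_mul, abs_abs]
      _ ≤ |c₁| + |c₂| * (|t₁| + (T - t₁)) := by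
          gcongr
          calc |T| = |t₁ + (T - t₁)| := by ring_nf
            _ ≤ |t₁| + |T - t₁| := abs_add_le _ _
            _ = |t₁| + (T - t₁) := by rw [abs_of_nonneg hTt]
  have hnn : 0 ≤ |c₁| + |c₂| * (|t₁| + (T - t₁)) := by positivity
  exact mul_le_mul hlin hexp (Real.exp_pos _).le hnn

/-- `(c₁ + c₂|T|) e^{-(T-t₁)²/(2h²)} ≤ ε` for `|T|` large. [folklore] -/
private theorem eventually_linear_mul_gauss_le (c₁ c₂ t₁ : ℝ) {h : ℝ} (hh : 0 < h) {ε : ℝ} (hε : 0 < ε) :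
    ∃ T₀ : ℝ, ∀ T : ℝ, T₀ ≤ |T| →
      (c₁ + c₂ * |T|) * Real.exp (-(T - t₁) ^ 2 / (2 * h ^ 2)) ≤ ε := by
  have h1 := tendsto_linear_mul_gauss_atTop c₁ c₂ t₁ hh
  have h2 := tendsto_linear_mul_gauss_atTop c₁ c₂ (-t₁) hh
  rw [Metric.tendsto_nhds] at h1 h2
  obtain ⟨N₁, hN₁⟩ := Filter.eventually_atTop.mp (h1 ε hε)
  obtain ⟨N₂, hN₂⟩ := Filter.eventually_atTop.mp (h2 ε hε)
  refine ⟨max (max N₁ N₂) 0, fun T hT => ?_⟩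
  rcases le_or_gt 0 T with hT0 | hT0
  · rw [abs_of_nonneg hT0] at hT
    have := hN₁ T (le_trans (le_trans (le_max_left _ _) (le_max_left _ _)) hT)
    rw [Real.dist_eq, sub_zero] at this
    exact (le_abs_self _).trans this.le
  · rw [abs_of_neg hT0] at hT
    have := hN₂ (-T) (le_trans (le_trans (le_max_right _ _) (le_max_left _ _)) hT)
    rw [Real.dist_eq, sub_zero, abs_neg, show (-T - -t₁) ^ 2 = (T - t₁) ^ 2 by ring] at this
    exact (le_abs_self _).trans this.le

/-- `(c₁ + c₂|τ|) e^{πτ/4} e^{-(τ-t₀)²/(2h²)}` is integrable (`h > 0`). [folklore] -/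
private theorem integrable_linear_mul_window (c₁ c₂ t₀ : ℝ) {h : ℝ} (hh : 0 < h) :
    Integrable fun τ : ℝ => (c₁ + c₂ * |τ|) *
      (Real.exp (π * τ / 4) * Real.exp (-(τ - t₀) ^ 2 / (2 * h ^ 2))) := by
  set t₁ : ℝ := t₀ + π * h ^ 2 / 4 with ht₁
  set κ : ℝ := Real.exp ((t₁ ^ 2 - t₀ ^ 2) / (2 * h ^ 2)) with hκ
  have h1 := ((integrable_gauss' hh t₁).const_mul (κ * c₁)).add
    ((integrable_abs_mul_gauss hh t₁).const_mul (κ * c₂))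
  refine h1.congr (ae_of_all _ fun τ => ?_)
  simp only [Pi.add_apply]
  rw [exp_mul_gauss_eq t₀ h τ hh.ne']
  ring

/-! ## §3 Platt's integrand `Ψ_x` on the strip `1/2 ≤ Re s ≤ 3 - a_χ` -/

/-- **The integrand on the strip.** For `1/2 ≤ Re s ≤ 3 - a_χ` Platt's integrand
`Ψ_x(s) = ε (q/π)^{(s-1/2)/2} Γ((s+a_χ)/2) exp(πi(1/2-s)/4) L_χ(s) exp((1/2-s)x) exp(-(i(1/2-s)-t₀)²/(2h²))`
(p. 3022) satisfies `‖Ψ_x(s)‖ ≤ K(q, x, h) · (1 + q(5+|Im s|)/(2π)) · e^{π Im s/4} e^{-(Im s - t₀)²/(2h²)}` with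
`K = max(1, q/π)^{5/4} max(Γ((1/2+a_χ)/2), Γ(3/2)) ζ(3/2) e^{5|x|/2} e^{(5/2)²/(2h²)}` — factor by factor:
`WindowAliasing.norm_LFunction_le_linear` for `L_χ`, `|Γ(w)| ≤ Γ(Re w)` and convexity of `Γ` for the
Gamma factor. This is the (unprinted) estimate that justifies the contour shift of the proof.
[cite: Platt2016GRH, Lemma 8.5 p. 3022 (proof pp. 3022–3023)] -/
theorem norm_integrand_le {q : ℕ} [NeZero q] (hq : 1 < q) {χ : DirichletCharacter ℂ q}
    (hχ : χ.IsPrimitive) {ε : ℂ} (hε : ‖ε‖ = 1) (t₀ x : ℝ) {h : ℝ} (hh : 0 < h) {s : ℂ}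
    (h1 : 1 / 2 ≤ s.re) (h2 : s.re ≤ 3 - charParity χ) :
    ‖ε * ((q : ℂ) / π) ^ ((s - 1 / 2) / 2) * Complex.Gamma ((s + charParity χ) / 2) *
        Complex.exp (π * I * (1 / 2 - s) / 4) * χ.LFunction s * Complex.exp ((1 / 2 - s) * x) *
        Complex.exp (-(I * (1 / 2 - s) - t₀) ^ 2 / (2 * h ^ 2))‖ ≤
      (max 1 ((q : ℝ) / π)) ^ ((5 : ℝ) / 4) *
        max (Real.Gamma ((1 / 2 + charParity χ) / 2)) (Real.Gamma (3 / 2)) *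
        Booker2006Turing.bigZ (3 / 2) * Real.exp (5 / 2 * |x|) * Real.exp ((5 / 2) ^ 2 / (2 * h ^ 2)) *
        ((1 + q * (5 + |s.im|) / (2 * π)) * (Real.exp (π * s.im / 4) *
          Real.exp (-(s.im - t₀) ^ 2 / (2 * h ^ 2)))) := by
  set a : ℕ := charParity χ with ha_def
  have ha1 : a ≤ 1 := charParity_le_one χ
  have ha1R : (a : ℝ) ≤ 1 := by exact_mod_cast ha1
  have hqpos : 0 < q := by omega
  have hqR : (0 : ℝ) < q := by exact_mod_cast hqpos
  have hqπ : 0 < (q : ℝ) / π := div_pos hqR Real.pi_pos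
  -- the seven factors
  have f1 : ‖ε‖ = 1 := hε
  have f2 : ‖((q : ℂ) / π) ^ ((s - 1 / 2) / 2)‖ ≤ (max 1 ((q : ℝ) / π)) ^ ((5 : ℝ) / 4) := by
    rw [norm_base_cpow hqpos]
    have he0 : 0 ≤ (s.re - 1 / 2) / 2 := by linarith
    have he1 : (s.re - 1 / 2) / 2 ≤ 5 / 4 := by linarith [(Nat.cast_nonneg a : (0 : ℝ) ≤ a)]
    calc ((q : ℝ) / π) ^ ((s.re - 1 / 2) / 2) ≤ (max 1 ((q : ℝ) / π)) ^ ((s.re - 1 / 2) / 2) :=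
          Real.rpow_le_rpow hqπ.le (le_max_right _ _) he0
      _ ≤ (max 1 ((q : ℝ) / π)) ^ ((5 : ℝ) / 4) :=
          Real.rpow_le_rpow_of_exponent_le (le_max_left _ _) he1
  have f3 : ‖Complex.Gamma ((s + a) / 2)‖ ≤ max (Real.Gamma ((1 / 2 + a) / 2)) (Real.Gamma (3 / 2)) := by
    refine (norm_Gamma_factor_le a (by linarith [(Nat.cast_nonneg a : (0 : ℝ) ≤ a)])).trans ?_
    exact Real_Gamma_le_max (by positivity) (by linarith) (by linarith)
  have f4 : ‖Complex.exp (π * I * (1 / 2 - s) / 4)‖ = Real.exp (π * s.im / 4) := norm_exp_phase s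
  have f5 : ‖χ.LFunction s‖ ≤ Booker2006Turing.bigZ (3 / 2) * (1 + q * (5 + |s.im|) / (2 * π)) :=
    norm_LFunction_le_linear hq hχ h1 (by linarith [(Nat.cast_nonneg a : (0 : ℝ) ≤ a)])
  have f6 : ‖Complex.exp ((1 / 2 - s) * x)‖ ≤ Real.exp (5 / 2 * |x|) := by
    rw [norm_exp_shift, Real.exp_le_exp]
    have hb : |1 / 2 - s.re| ≤ 5 / 2 := by
      rw [abs_le]; constructor <;> linarith [(Nat.cast_nonneg a : (0 : ℝ) ≤ a)]
    calc (1 / 2 - s.re) * x ≤ |(1 / 2 - s.re) * x| := le_abs_self _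
      _ = |1 / 2 - s.re| * |x| := abs_mul _ _
      _ ≤ 5 / 2 * |x| := by gcongr
  have f7 : ‖Complex.exp (-(I * (1 / 2 - s) - t₀) ^ 2 / (2 * h ^ 2))‖ ≤
      Real.exp ((5 / 2) ^ 2 / (2 * h ^ 2)) * Real.exp (-(s.im - t₀) ^ 2 / (2 * h ^ 2)) := by
    rw [norm_exp_gauss, ← Real.exp_add, Real.exp_le_exp, sub_div, neg_div]
    have hb : (s.re - 1 / 2) ^ 2 ≤ (5 / 2) ^ 2 := by
      have : |s.re - 1 / 2| ≤ 5 / 2 := by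
        rw [abs_le]; constructor <;> linarith [(Nat.cast_nonneg a : (0 : ℝ) ≤ a)]
      nlinarith [abs_nonneg (s.re - 1 / 2), sq_abs (s.re - 1 / 2)]
    have := div_le_div_of_nonneg_right hb (by positivity : (0 : ℝ) ≤ 2 * h ^ 2)
    linarith
  -- assemble
  have hZ : 0 ≤ Booker2006Turing.bigZ (3 / 2) := (Booker2006Turing.bigZ_pos (by norm_num)).le
  rw [norm_mul, norm_mul, norm_mul, norm_mul, norm_mul, norm_mul, f1, one_mul, f4]
  have hG0 : 0 ≤ max (Real.Gamma ((1 / 2 + a) / 2)) (Real.Gamma (3 / 2)) :=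
    le_max_of_le_right (Real.Gamma_pos_of_pos (by norm_num)).le
  calc ‖((q : ℂ) / π) ^ ((s - 1 / 2) / 2)‖ * ‖Complex.Gamma ((s + a) / 2)‖ *
        Real.exp (π * s.im / 4) * ‖χ.LFunction s‖ * ‖Complex.exp ((1 / 2 - s) * x)‖ *
        ‖Complex.exp (-(I * (1 / 2 - s) - t₀) ^ 2 / (2 * h ^ 2))‖
      ≤ (max 1 ((q : ℝ) / π)) ^ ((5 : ℝ) / 4) *
          max (Real.Gamma ((1 / 2 + a) / 2)) (Real.Gamma (3 / 2)) *
          Real.exp (π * s.im / 4) * (Booker2006Turing.bigZ (3 / 2) * (1 + q * (5 + |s.im|) / (2 * π))) *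
          Real.exp (5 / 2 * |x|) *
          (Real.exp ((5 / 2) ^ 2 / (2 * h ^ 2)) * Real.exp (-(s.im - t₀) ^ 2 / (2 * h ^ 2))) := by
        gcongr
    _ = _ := by ring

/-- **`Ψ_x` is holomorphic on `Re s ≥ 1/2`** (indeed on `Re s > -a_χ`): `L_χ` is entire for primitive `χ`
with `q > 1` (Mathlib's `DirichletCharacter.differentiable_LFunction`), `Γ((s+a_χ)/2)` has no pole there,
and `(q/π)^{(s-1/2)/2}` is an exponential. [cite: Platt2016GRH, Lemma 8.5 p. 3022 (proof pp. 3022–3023)] -/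
theorem differentiableAt_integrand {q : ℕ} [NeZero q] (hq : 1 < q) {χ : DirichletCharacter ℂ q}
    (hχ : χ.IsPrimitive) (ε : ℂ) (t₀ x h : ℝ) {s : ℂ} (h1 : 1 / 2 ≤ s.re) :
    DifferentiableAt ℂ (fun s : ℂ => ε * ((q : ℂ) / π) ^ ((s - 1 / 2) / 2) *
        Complex.Gamma ((s + charParity χ) / 2) *
        Complex.exp (π * I * (1 / 2 - s) / 4) * χ.LFunction s * Complex.exp ((1 / 2 - s) * x) *
        Complex.exp (-(I * (1 / 2 - s) - t₀) ^ 2 / (2 * h ^ 2))) s := by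
  have hq1 : q ≠ 1 := by omega
  have hχ1 : χ ≠ 1 := SelbergDirichlet.ne_one_of_isPrimitive hq1 hχ
  have hqπ : ((q : ℂ) / π) ≠ 0 := by
    apply div_ne_zero
    · exact_mod_cast (show q ≠ 0 by omega)
    · exact_mod_cast Real.pi_pos.ne'
  have d2 : DifferentiableAt ℂ (fun s : ℂ => ((q : ℂ) / π) ^ ((s - 1 / 2) / 2)) s :=
    DifferentiableAt.const_cpow (by fun_prop) (Or.inl hqπ)
  have d3 : DifferentiableAt ℂ (fun s : ℂ => Complex.Gamma ((s + charParity χ) / 2)) s := by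
    refine (Complex.differentiableAt_Gamma _ fun m => ?_).comp s (by fun_prop)
    intro hm
    have := congrArg Complex.re hm
    simp at this
    have h0 : (0 : ℝ) ≤ charParity χ := Nat.cast_nonneg _
    have hm0 : (0 : ℝ) ≤ m := Nat.cast_nonneg _
    linarith
  have d5 : DifferentiableAt ℂ (fun s : ℂ => χ.LFunction s) s :=
    (differentiable_LFunction hχ1).differentiableAt
  have d4 : DifferentiableAt ℂ (fun s : ℂ => Complex.exp (π * I * (1 / 2 - s) / 4)) s := by fun_prop
  have d6 : DifferentiableAt ℂ (fun s : ℂ => Complex.exp ((1 / 2 - s) * x)) s := by fun_prop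
  have d7 : DifferentiableAt ℂ (fun s : ℂ => Complex.exp (-(I * (1 / 2 - s) - t₀) ^ 2 / (2 * h ^ 2)))
      s := by fun_prop
  exact ((((((differentiableAt_const ε).mul d2).mul d3).mul d4).mul d5).mul d6).mul d7

/-- **`Ψ_x` is integrable on every vertical line `Re s = σ`, `1/2 ≤ σ ≤ 3 - a_χ`** (continuity and the
Gaussian majorant `WindowAliasing.norm_integrand_le`), so that both sides of the contour shift are honest
Bochner integrals. [cite: Platt2016GRH, Lemma 8.5 p. 3022 (proof pp. 3022–3023)] -/
theorem integrable_integrand_vertical {q : ℕ} [NeZero q] (hq : 1 < q) {χ : DirichletCharacter ℂ q}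
    (hχ : χ.IsPrimitive) {ε : ℂ} (hε : ‖ε‖ = 1) (t₀ x : ℝ) {h : ℝ} (hh : 0 < h) {σ : ℝ}
    (h1 : 1 / 2 ≤ σ) (h2 : σ ≤ 3 - charParity χ) :
    Integrable fun τ : ℝ => (fun s : ℂ => ε * ((q : ℂ) / π) ^ ((s - 1 / 2) / 2) *
        Complex.Gamma ((s + charParity χ) / 2) *
        Complex.exp (π * I * (1 / 2 - s) / 4) * χ.LFunction s * Complex.exp ((1 / 2 - s) * x) *
        Complex.exp (-(I * (1 / 2 - s) - t₀) ^ 2 / (2 * h ^ 2))) ((σ : ℂ) + τ * I) := by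
  set K : ℝ := (max 1 ((q : ℝ) / π)) ^ ((5 : ℝ) / 4) *
        max (Real.Gamma ((1 / 2 + charParity χ) / 2)) (Real.Gamma (3 / 2)) *
        Booker2006Turing.bigZ (3 / 2) * Real.exp (5 / 2 * |x|) * Real.exp ((5 / 2) ^ 2 / (2 * h ^ 2))
    with hK
  have hg := (integrable_linear_mul_window (1 + q * 5 / (2 * π)) (q / (2 * π)) t₀ hh).const_mul K
  have hcont : Continuous fun τ : ℝ => (fun s : ℂ => ε * ((q : ℂ) / π) ^ ((s - 1 / 2) / 2) *
        Complex.Gamma ((s + charParity χ) / 2) *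
        Complex.exp (π * I * (1 / 2 - s) / 4) * χ.LFunction s * Complex.exp ((1 / 2 - s) * x) *
        Complex.exp (-(I * (1 / 2 - s) - t₀) ^ 2 / (2 * h ^ 2))) ((σ : ℂ) + τ * I) := by
    have hl : Continuous fun τ : ℝ => ((σ : ℂ) + τ * I) := by fun_prop
    have hGon : ContinuousOn _ {s : ℂ | 1 / 2 ≤ s.re} := fun s (hs : 1 / 2 ≤ s.re) =>
      (differentiableAt_integrand hq hχ ε t₀ x h (s := s) hs).continuousAt.continuousWithinAt
    have hmem : ∀ τ : ℝ, ((σ : ℂ) + τ * I) ∈ {s : ℂ | 1 / 2 ≤ s.re} := fun τ => by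
      simpa using h1
    have hc := hGon.comp_continuous hl hmem
    exact hc
  refine hg.mono' hcont.aestronglyMeasurable (ae_of_all _ fun τ => ?_)
  have hb := norm_integrand_le hq hχ hε t₀ x hh (s := (σ : ℂ) + τ * I) (by simpa using h1)
    (by simpa using h2)
  have hsim : ((σ : ℂ) + τ * I).im = τ := by simp
  rw [hsim] at hb
  refine hb.trans (le_of_eq ?_)
  simp only [hK]
  ring

/-- **The integrand on the shifted line `Re s = 3 - a_χ = M + 1/2`** (the display of p. 3023):
`|Ψ_x(M + 1/2 + it)| ≤ (q/π)^{M/2} ζ(M + 1/2) e^{-Mx} e^{M²/(2h²)} · |Γ((3+it)/2)| e^{πt/4} e^{-(t-t₀)²/(2h²)}`,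
`M = 5/2 - a_χ`: `|(q/π)^{(s-1/2)/2}| = (q/π)^{M/2}`, `Γ((s+a_χ)/2) = Γ((3+it)/2)` for both parities,
`|exp(πi(1/2-s)/4)| = e^{πt/4}`, `|L_χ(s)| ≤ ζ(M+1/2)` (`Booker2006Turing.norm_LFunction_le_bigZ`),
`|exp((1/2-s)x)| = e^{-Mx}`, `|exp(-(i(1/2-s)-t₀)²/(2h²))| = e^{(M²-(t-t₀)²)/(2h²)}`.
[cite: Platt2016GRH, Lemma 8.5 p. 3022 (proof pp. 3022–3023)] -/
theorem norm_integrand_far_le {q : ℕ} [NeZero q] (hq : 1 < q) {χ : DirichletCharacter ℂ q}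
    {ε : ℂ} (hε : ‖ε‖ = 1) (t₀ x : ℝ) (h τ : ℝ) :
    ‖(fun s : ℂ => ε * ((q : ℂ) / π) ^ ((s - 1 / 2) / 2) *
        Complex.Gamma ((s + charParity χ) / 2) *
        Complex.exp (π * I * (1 / 2 - s) / 4) * χ.LFunction s * Complex.exp ((1 / 2 - s) * x) *
        Complex.exp (-(I * (1 / 2 - s) - t₀) ^ 2 / (2 * h ^ 2)))
        (((3 - charParity χ : ℝ) : ℂ) + τ * I)‖ ≤
      ((q : ℝ) / π) ^ ((5 / 2 - charParity χ : ℝ) / 2) *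
        Booker2006Turing.bigZ (3 - charParity χ) *
        Real.exp (-(5 / 2 - charParity χ : ℝ) * x) *
        Real.exp ((5 / 2 - charParity χ : ℝ) ^ 2 / (2 * h ^ 2)) *
        (‖Complex.Gamma ((3 + τ * I) / 2)‖ * Real.exp (π * τ / 4) *
          Real.exp (-(τ - t₀) ^ 2 / (2 * h ^ 2))) := by
  set a : ℕ := charParity χ with ha_def
  have ha1 : a ≤ 1 := charParity_le_one χ
  have ha1R : (a : ℝ) ≤ 1 := by exact_mod_cast ha1
  have hqpos : 0 < q := by omega
  set s : ℂ := (((3 - a : ℝ)) : ℂ) + τ * I with hs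
  have hsre : s.re = 3 - a := by simp [hs]
  have hsim : s.im = τ := by simp [hs]
  have f2 : ‖((q : ℂ) / π) ^ ((s - 1 / 2) / 2)‖ = ((q : ℝ) / π) ^ ((5 / 2 - a : ℝ) / 2) := by
    rw [norm_base_cpow hqpos, hsre]; ring_nf
  have f3 : Complex.Gamma ((s + a) / 2) = Complex.Gamma ((3 + τ * I) / 2) := by
    congr 1; simp only [hs]; push_cast; ring
  have f4 : ‖Complex.exp (π * I * (1 / 2 - s) / 4)‖ = Real.exp (π * τ / 4) := by
    rw [norm_exp_phase, hsim]
  have f5 : ‖χ.LFunction s‖ ≤ Booker2006Turing.bigZ (3 - a) := by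
    have := Booker2006Turing.norm_LFunction_le_bigZ χ (σ := 3 - a) (by linarith) τ
    simpa [hs] using this
  have f6 : ‖Complex.exp ((1 / 2 - s) * x)‖ = Real.exp (-(5 / 2 - a : ℝ) * x) := by
    rw [norm_exp_shift, hsre]; ring_nf
  have f7 : ‖Complex.exp (-(I * (1 / 2 - s) - t₀) ^ 2 / (2 * h ^ 2))‖ =
      Real.exp ((5 / 2 - a : ℝ) ^ 2 / (2 * h ^ 2)) * Real.exp (-(τ - t₀) ^ 2 / (2 * h ^ 2)) := by
    rw [norm_exp_gauss, hsre, hsim, ← Real.exp_add]; ring_nf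
  simp only []
  rw [norm_mul, norm_mul, norm_mul, norm_mul, norm_mul, norm_mul, hε, one_mul, f2, f3, f4, f6, f7]
  have hZ : 0 ≤ Booker2006Turing.bigZ (3 - a) := (Booker2006Turing.bigZ_pos (by linarith)).le
  calc ((q : ℝ) / π) ^ ((5 / 2 - a : ℝ) / 2) * ‖Complex.Gamma ((3 + τ * I) / 2)‖ *
        Real.exp (π * τ / 4) * ‖χ.LFunction s‖ * Real.exp (-(5 / 2 - a : ℝ) * x) *
        (Real.exp ((5 / 2 - a : ℝ) ^ 2 / (2 * h ^ 2)) * Real.exp (-(τ - t₀) ^ 2 / (2 * h ^ 2)))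
      ≤ ((q : ℝ) / π) ^ ((5 / 2 - a : ℝ) / 2) * ‖Complex.Gamma ((3 + τ * I) / 2)‖ *
        Real.exp (π * τ / 4) * Booker2006Turing.bigZ (3 - a) * Real.exp (-(5 / 2 - a : ℝ) * x) *
        (Real.exp ((5 / 2 - a : ℝ) ^ 2 / (2 * h ^ 2)) * Real.exp (-(τ - t₀) ^ 2 / (2 * h ^ 2))) := by
        gcongr
    _ = _ := by ring

/-- **"Writing `s = 1/2 + it`"** (p. 3022): the Fourier integrand `W(t, χ) e^{-ixt}` of `I_χ(A)`, with
`W(t, χ) = ε (q/π)^{it/2} Γ((1/2 + a_χ + it)/2) e^{πt/4} L_χ(1/2+it) e^{-(t-t₀)²/(2h²)}` (pp. 3009, 3021), IS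
Platt's integrand `Ψ_x` at `s = 1/2 + it`. [cite: Platt2016GRH, Lemma 8.5 p. 3022 (proof pp. 3022–3023)] -/
theorem window_mul_exp_eq {q : ℕ} [NeZero q] (χ : DirichletCharacter ℂ q) (ε : ℂ) (t₀ x h t : ℝ) :
    ε * ((q : ℂ) / π) ^ (I * t / 2) * Complex.Gamma ((1 / 2 + charParity χ + I * t) / 2) *
        Complex.exp (π * t / 4) * χ.LFunction (1 / 2 + I * t) *
        (Real.exp (-(t - t₀) ^ 2 / (2 * h ^ 2)) : ℂ) * Complex.exp (-I * x * t) =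
      (fun s : ℂ => ε * ((q : ℂ) / π) ^ ((s - 1 / 2) / 2) *
        Complex.Gamma ((s + charParity χ) / 2) *
        Complex.exp (π * I * (1 / 2 - s) / 4) * χ.LFunction s * Complex.exp ((1 / 2 - s) * x) *
        Complex.exp (-(I * (1 / 2 - s) - t₀) ^ 2 / (2 * h ^ 2))) ((((1 / 2 : ℝ)) : ℂ) + t * I) := by
  have e0 : ((((1 / 2 : ℝ)) : ℂ) + t * I) = 1 / 2 + t * I := by push_cast; ring
  simp only [e0]
  have e1 : ((1 / 2 + (t : ℂ) * I) - 1 / 2) / 2 = I * t / 2 := by ring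
  have e2 : ((1 / 2 + (t : ℂ) * I) + (charParity χ : ℂ)) / 2 = (1 / 2 + charParity χ + I * t) / 2 := by
    ring
  have e3 : (π : ℂ) * I * (1 / 2 - (1 / 2 + t * I)) / 4 = ((π * t / 4 : ℝ) : ℂ) := by
    push_cast; ring_nf; rw [Complex.I_sq]; ring
  have e4 : (1 / 2 - (1 / 2 + (t : ℂ) * I)) * x = -I * x * t := by ring
  have e5a : I * (1 / 2 - (1 / 2 + (t : ℂ) * I)) = t := by
    have : I * (1 / 2 - (1 / 2 + (t : ℂ) * I)) = -(I * I) * t := by ring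
    rw [this, Complex.I_mul_I]; ring
  have e5 : -(I * (1 / 2 - (1 / 2 + (t : ℂ) * I)) - t₀) ^ 2 / (2 * (h : ℂ) ^ 2) =
      ((-(t - t₀) ^ 2 / (2 * h ^ 2) : ℝ) : ℂ) := by
    rw [e5a]; push_cast; ring
  rw [e1, e2, e3, e4, e5, (Complex.ofReal_exp _).symm, (Complex.ofReal_exp _).symm]
  push_cast
  ring

/-- **Uniform decay at the top and bottom of the strip:** for every `η > 0`, `‖Ψ_x(σ + iT)‖ ≤ η` for all
`σ ∈ [1/2, 3 - a_χ]` once `|T|` is large (the Gaussian window against the linear growth of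
`WindowAliasing.norm_integrand_le`) — the hypothesis of the tree's rectangle-to-strip lemma
`Literature.Analysis.Complex.integral_vertical_eq_of_differentiableOn` that performs the printed
"shift the contour of integration to the right". [cite: Platt2016GRH, Lemma 8.5 p. 3022 (proof pp. 3022–3023)] -/
theorem decay_integrand {q : ℕ} [NeZero q] (hq : 1 < q) {χ : DirichletCharacter ℂ q}
    (hχ : χ.IsPrimitive) {ε : ℂ} (hε : ‖ε‖ = 1) (t₀ x : ℝ) {h : ℝ} (hh : 0 < h) :
    ∀ η : ℝ, 0 < η → ∃ T₀ : ℝ, ∀ T : ℝ, T₀ ≤ |T| → ∀ σ ∈ Icc (1 / 2 : ℝ) (3 - charParity χ),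
      ‖(fun s : ℂ => ε * ((q : ℂ) / π) ^ ((s - 1 / 2) / 2) *
        Complex.Gamma ((s + charParity χ) / 2) *
        Complex.exp (π * I * (1 / 2 - s) / 4) * χ.LFunction s * Complex.exp ((1 / 2 - s) * x) *
        Complex.exp (-(I * (1 / 2 - s) - t₀) ^ 2 / (2 * h ^ 2))) ((σ : ℂ) + T * I)‖ ≤ η := by
  intro η hη
  set K : ℝ := (max 1 ((q : ℝ) / π)) ^ ((5 : ℝ) / 4) *
        max (Real.Gamma ((1 / 2 + charParity χ) / 2)) (Real.Gamma (3 / 2)) *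
        Booker2006Turing.bigZ (3 / 2) * Real.exp (5 / 2 * |x|) * Real.exp ((5 / 2) ^ 2 / (2 * h ^ 2))
    with hK
  have hΓ : 0 < max (Real.Gamma ((1 / 2 + charParity χ) / 2)) (Real.Gamma (3 / 2)) :=
    lt_max_of_lt_right (Real.Gamma_pos_of_pos (by norm_num))
  have hZ : 0 < Booker2006Turing.bigZ (3 / 2) := Booker2006Turing.bigZ_pos (by norm_num)
  have hKpos : 0 < K := by positivity
  set κ : ℝ := Real.exp (((t₀ + π * h ^ 2 / 4) ^ 2 - t₀ ^ 2) / (2 * h ^ 2)) with hκ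
  have hκpos : 0 < κ := Real.exp_pos _
  obtain ⟨T₀, hT₀⟩ := eventually_linear_mul_gauss_le (1 + q * 5 / (2 * π)) (q / (2 * π))
    (t₀ + π * h ^ 2 / 4) hh (ε := η / (K * κ)) (by positivity)
  refine ⟨T₀, fun T hT σ hσ => ?_⟩
  have hb := norm_integrand_le hq hχ hε t₀ x hh (s := (σ : ℂ) + T * I) (by simpa using hσ.1)
    (by simpa using hσ.2)
  have hsim : ((σ : ℂ) + T * I).im = T := by simp
  rw [hsim] at hb
  refine hb.trans ?_
  have h1 := hT₀ T hT
  calc K * ((1 + q * (5 + |T|) / (2 * π)) *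
        (Real.exp (π * T / 4) * Real.exp (-(T - t₀) ^ 2 / (2 * h ^ 2))))
      = K * κ * ((1 + q * 5 / (2 * π) + q / (2 * π) * |T|) *
          Real.exp (-(T - (t₀ + π * h ^ 2 / 4)) ^ 2 / (2 * h ^ 2))) := by
        rw [exp_mul_gauss_eq t₀ h T hh.ne']; ring
    _ ≤ K * κ * (η / (K * κ)) := by gcongr
    _ = η := by field_simp

end WindowAliasing

open WindowAliasing

/-! ## §4 Lemma 8.5: `I_χ(A) ≤ 2 (q/π)^{M/2} ζ(M+1/2) e^{M²/(2h²) - πAM} P(t₀, h)/(πM)` -/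

/-- **Platt 2016, Lemma 8.5 (Math. Comp. 85, p. 3022; proof pp. 3022–3023; arXiv:1305.3087v1
Lemma 6.4), as printed:** "Define `P(t₀, h)` as in Lemma 8.4 and `I_χ(A)` for `A > 0` by
`I_χ(A) := 4 ∫_{πA}^{∞} |(1/(2π)) ∫_{-∞}^{∞} W(t, χ) exp(-ixt) dt| dx`.
Then, writing `M` in place of `5/2 - a_χ` we have
`I_χ(A) ≤ 2 (q/π)^{M/2} ζ(M + 1/2) exp(M²/(2h²) - πAM) P(t₀, h)/(πM)`."
Here `χ` is a primitive character mod `q > 1` of parity `a_χ = charParity χ`,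
`W(t, χ) = Λ_χ(t) exp(-(t-t₀)²/(2h²))` (p. 3021) with Platt's completed `L`-function
`Λ_χ(t) = ε_χ (q/π)^{it/2} Γ((1/2 + a_χ + it)/2) exp(πt/4) L_χ(1/2 + it)` (p. 3009, any `ε_χ` with
`|ε_χ| = 1`), written out over Mathlib's `DirichletCharacter.LFunction`/`Complex.Gamma`; `P(t₀, h)` is
the integral of `platt2016_lemma84`, `ζ(M + 1/2) = Booker2006Turing.bigZ (M + 1/2)` (real, as
`M + 1/2 = 3 - a_χ ≥ 2`), and the outer integral is the Bochner integral over `Ioi (πA)` (so the bound is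
stated for every real `A`; with `h > 0`, `t₀ ∈ ℝ`). Proof = the printed one (module docstring): the
inner integral is the line integral of `Ψ_x` over `Re s = 1/2` (`WindowAliasing.window_mul_exp_eq`),
moved to `Re s = M + 1/2` (`integral_vertical_eq_of_differentiableOn` with
`WindowAliasing.differentiableAt_integrand/integrable_integrand_vertical/decay_integrand`), bounded
there by `WindowAliasing.norm_integrand_far_le`, then `∫ dt` gives `P(t₀, h)` and
`4 · (1/(2π)) ∫_{πA}^∞ e^{-Mx} dx = 2 e^{-πAM}/(πM)`. [cite: Platt2016GRH, Lemma 8.5 p. 3022] -/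
theorem platt2016_lemma85 {q : ℕ} [NeZero q] (hq : 1 < q) {χ : DirichletCharacter ℂ q}
    (hχ : χ.IsPrimitive) {ε : ℂ} (hε : ‖ε‖ = 1) (t₀ : ℝ) {h : ℝ} (hh : 0 < h) (A M : ℝ)
    (hM : M = 5 / 2 - (charParity χ : ℝ)) :
    4 * ∫ x in Ioi (π * A), 1 / (2 * π) *
        ‖∫ t : ℝ, ε * ((q : ℂ) / π) ^ (I * t / 2) *
            Complex.Gamma ((1 / 2 + charParity χ + I * t) / 2) * Complex.exp (π * t / 4) *
            χ.LFunction (1 / 2 + I * t) * (Real.exp (-(t - t₀) ^ 2 / (2 * h ^ 2)) : ℂ) *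
            Complex.exp (-I * x * t)‖ ≤
      2 * ((q : ℝ) / π) ^ (M / 2) * Booker2006Turing.bigZ (M + 1 / 2) *
        Real.exp (M ^ 2 / (2 * h ^ 2) - π * A * M) *
        (∫ t : ℝ, ‖Complex.Gamma ((3 + t * I) / 2)‖ * Real.exp (π * t / 4) *
          Real.exp (-(t - t₀) ^ 2 / (2 * h ^ 2))) / (π * M) := by
  subst hM
  have ha1 : (charParity χ : ℝ) ≤ 1 := by exact_mod_cast charParity_le_one χ
  have hMpos : 0 < 5 / 2 - (charParity χ : ℝ) := by linarith
  have hab : (1 / 2 : ℝ) ≤ 3 - charParity χ := by linarith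
  have hZ : 0 < Booker2006Turing.bigZ (3 - charParity χ) := Booker2006Turing.bigZ_pos (by linarith)
  -- the `x`-independent constant `(q/π)^{M/2} ζ(M+1/2) e^{M²/(2h²)} P(t₀, h)`
  set C : ℝ := ((q : ℝ) / π) ^ ((5 / 2 - charParity χ : ℝ) / 2) *
      Booker2006Turing.bigZ (3 - charParity χ) *
      Real.exp ((5 / 2 - charParity χ : ℝ) ^ 2 / (2 * h ^ 2)) *
      (∫ t : ℝ, ‖Complex.Gamma ((3 + t * I) / 2)‖ * Real.exp (π * t / 4) *
        Real.exp (-(t - t₀) ^ 2 / (2 * h ^ 2))) with hC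
  -- Step 1 (pp. 3022–3023): the inner integral is a line integral over `Re s = 1/2`; move it to
  -- `Re s = M + 1/2 = 3 - a_χ` and bound it there.
  have key : ∀ x : ℝ, 1 / (2 * π) *
      ‖∫ t : ℝ, ε * ((q : ℂ) / π) ^ (I * t / 2) *
          Complex.Gamma ((1 / 2 + charParity χ + I * t) / 2) * Complex.exp (π * t / 4) *
          χ.LFunction (1 / 2 + I * t) * (Real.exp (-(t - t₀) ^ 2 / (2 * h ^ 2)) : ℂ) *
          Complex.exp (-I * x * t)‖ ≤
      1 / (2 * π) * C * Real.exp (-(5 / 2 - charParity χ : ℝ) * x) := by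
    intro x
    have h1 := integral_congr_ae (ae_of_all (volume : Measure ℝ) fun t =>
      window_mul_exp_eq χ ε t₀ x h t)
    have hshift := Literature.Analysis.Complex.integral_vertical_eq_of_differentiableOn
      (F := fun s : ℂ => ε * ((q : ℂ) / π) ^ ((s - 1 / 2) / 2) *
        Complex.Gamma ((s + charParity χ) / 2) *
        Complex.exp (π * I * (1 / 2 - s) / 4) * χ.LFunction s * Complex.exp ((1 / 2 - s) * x) *
        Complex.exp (-(I * (1 / 2 - s) - t₀) ^ 2 / (2 * h ^ 2)))
      (a := 1 / 2) (b := 3 - charParity χ) hab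
      (fun s hs => (differentiableAt_integrand hq hχ ε t₀ x h (s := s) hs.1).differentiableWithinAt)
      (integrable_integrand_vertical hq hχ hε t₀ x hh (σ := 1 / 2) le_rfl hab)
      (integrable_integrand_vertical hq hχ hε t₀ x hh (σ := 3 - charParity χ) hab le_rfl)
      (decay_integrand hq hχ hε t₀ x hh)
    have hI := h1.trans hshift
    have hnear := (integrable_integrand_vertical hq hχ hε t₀ x hh (σ := 3 - charParity χ) hab
      le_rfl).norm
    have hfarI := (platt2016_lemma84_integrable t₀ hh).const_mul
      (((q : ℝ) / π) ^ ((5 / 2 - charParity χ : ℝ) / 2) *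
        Booker2006Turing.bigZ (3 - charParity χ) *
        Real.exp (-(5 / 2 - charParity χ : ℝ) * x) *
        Real.exp ((5 / 2 - charParity χ : ℝ) ^ 2 / (2 * h ^ 2)))
    have h2 : ‖∫ t : ℝ, ε * ((q : ℂ) / π) ^ (I * t / 2) *
          Complex.Gamma ((1 / 2 + charParity χ + I * t) / 2) * Complex.exp (π * t / 4) *
          χ.LFunction (1 / 2 + I * t) * (Real.exp (-(t - t₀) ^ 2 / (2 * h ^ 2)) : ℂ) *
          Complex.exp (-I * x * t)‖ ≤
        ((q : ℝ) / π) ^ ((5 / 2 - charParity χ : ℝ) / 2) *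
          Booker2006Turing.bigZ (3 - charParity χ) *
          Real.exp (-(5 / 2 - charParity χ : ℝ) * x) *
          Real.exp ((5 / 2 - charParity χ : ℝ) ^ 2 / (2 * h ^ 2)) *
          (∫ t : ℝ, ‖Complex.Gamma ((3 + t * I) / 2)‖ * Real.exp (π * t / 4) *
            Real.exp (-(t - t₀) ^ 2 / (2 * h ^ 2))) := by
      rw [hI]
      refine (norm_integral_le_integral_norm _).trans ?_
      rw [← integral_const_mul]
      exact integral_mono hnear hfarI fun y => norm_integrand_far_le hq hε t₀ x h y
    refine (mul_le_mul_of_nonneg_left h2 (by positivity)).trans (le_of_eq ?_)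
    simp only [hC]
    ring
  -- Step 2: `∫_{πA}^∞ e^{-Mx} dx = e^{-πAM}/M`.
  have hgi := Integrable.const_mul (integrableOn_exp_mul_Ioi
    (a := -(5 / 2 - (charParity χ : ℝ))) (by linarith) (π * A)) (1 / (2 * π) * C)
  have hout := integral_mono_of_nonneg (μ := volume.restrict (Ioi (π * A)))
    (ae_of_all _ fun x => (by positivity : (0 : ℝ) ≤ 1 / (2 * π) *
      ‖∫ t : ℝ, ε * ((q : ℂ) / π) ^ (I * t / 2) *
          Complex.Gamma ((1 / 2 + charParity χ + I * t) / 2) * Complex.exp (π * t / 4) *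
          χ.LFunction (1 / 2 + I * t) * (Real.exp (-(t - t₀) ^ 2 / (2 * h ^ 2)) : ℂ) *
          Complex.exp (-I * x * t)‖)) hgi (ae_of_all _ key)
  have hval : ∫ x in Ioi (π * A), 1 / (2 * π) * C * Real.exp (-(5 / 2 - charParity χ : ℝ) * x) =
      1 / (2 * π) * C *
        (-Real.exp (-(5 / 2 - charParity χ : ℝ) * (π * A)) / -(5 / 2 - (charParity χ : ℝ))) := by
    rw [integral_const_mul, integral_exp_mul_Ioi (by linarith)]
  rw [hval] at hout
  refine (mul_le_mul_of_nonneg_left hout (by norm_num)).trans (le_of_eq ?_)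
  -- Step 3: bookkeeping of the constants.
  set P : ℝ := (∫ t : ℝ, ‖Complex.Gamma ((3 + t * I) / 2)‖ * Real.exp (π * t / 4) *
    Real.exp (-(t - t₀) ^ 2 / (2 * h ^ 2))) with hP
  have e1 : (5 / 2 - (charParity χ : ℝ)) + 1 / 2 = 3 - charParity χ := by ring
  have e2 : -(5 / 2 - (charParity χ : ℝ)) * (π * A) = -(π * A * (5 / 2 - (charParity χ : ℝ))) := by
    ring
  rw [e1, e2, Real.exp_neg, Real.exp_sub, hC]
  field_simp
  ring

end Literature.NumberTheory.LFunctions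

end
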